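import Summits.FinalStateConjecture.FinalStateConjecture.Theses.ExactKerrEnds
import Literature.Geometry.Lorentzian.ExactKerrEnd

/-! Sketch — first lemmas of line `kerr-ended-attraction` (signatures only; crux-strategist
stmt-FinalStateConjecture-18520). -/

noncomputable section
set_option linter.dupNamespace false
open Set Function
open scoped Manifold ContDiff
open Literature.Geometry.Lorentzian

namespace Summit.FinalStateConjecture.FinalStateConjecture.Cruxes.SettlingAlongCensoredKerrEnds.KerrEndedAttraction

variable {X : Type} [TopologicalSpace X] [ChartedSpace E3 X] [IsManifold (𝓡 3) ∞ X] [T2Space X]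
  [SecondCountableTopology X] [ConnectedSpace X]

/-- FIRST LEMMA of stub K (constant case at a third-law datum): **censorship is transported along
pull-back by a diffeomorphism** — every maximal vacuum Cauchy development of `Φ^* D` is one of `D`
with the embedding precomposed by `Φ⁻¹`, and complete 𝓘⁺ (sojourn form) only sees the embedded
hypersurface. With `HasExactKerrEnd.comap_diffeomorph` (landed) and the same transport for "admits
an honest C⁰ decomposition (with sub-extremal holes)", the breathing self-witness
`InitialDataSet.exists_tame_selfWitness` (landed: tame, injective, immersed, admissible, isometric
copies of `d` agreeing off a compact set) discharges K along constant curves at data that already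
obey the third law; what remains of K is the genuine kick. M-sized transport bookkeeping. -/
theorem censored_comap_diffeomorph {D : InitialDataSet (𝓡 3) X}
    (hD : ∀ 𝒟 : VacuumCauchyDevelopment D, 𝒟.IsMaximal →
      Summit.FinalStateConjecture.HasCompleteNullInfinity 𝒟.toCauchyDevelopment)
    (Φ : Diffeomorph (𝓡 3) (𝓡 3) X X ∞) (hΦ : ContMDiff (𝓡 3) (𝓡 3) (∞ + 1) Φ)
    (hΦ' : ∀ u, Injective (mfderiv (𝓡 3) (𝓡 3) Φ u)) :
    ∀ 𝒟 : VacuumCauchyDevelopment (D.comap Φ hΦ hΦ'), 𝒟.IsMaximal →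
      Summit.FinalStateConjecture.HasCompleteNullInfinity 𝒟.toCauchyDevelopment := by
  sorry

/-- FIRST LEMMA of stubs X₁/U (why the Kerr-ended restriction removes the far field): the route's
support item `ExactKerrFarDevelopment` (stmt-FinalStateConjecture-18523), by name. -/
example : Prop := Summit.FinalStateConjecture.FinalStateConjecture.Theses.ExactKerrEnds.ExactKerrFarDevelopment

/-! ### Census signatures (STRATEGY-CENSUS.md) -/

/-- STRENGTHEN S⁺ (parametric unfolding): along a censored Kerr-ended tame curve `F`, a tame
TWO-parameter admissible family `G` with `G (c, 0) = F c` whose members with both coordinates non-zero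
are Settled, and whose diagonal is injective and immersed. `C₂ ⇐ S⁺` by the diagonal `c ↦ G (c, c)`
(`IsTameDataFamily.comp_contDiff`). Exposes exactly the uniformity C₂ needs (the unfolding directions
must converge as `c → 0`) and localises all dynamics at the censored Kerr-ended members `F c`, `c ≠ 0`,
never at `F 0` — but hands no tool: the unfolding of each member is the third law + settling again. -/
def ParametricSettledUnfolding : Prop :=
  ∀ (X : Type) [TopologicalSpace X] [ChartedSpace E3 X] [IsManifold (𝓡 3) ∞ X] [T2Space X]
    [SecondCountableTopology X] [ConnectedSpace X],
    ∀ (Settled : InitialDataSet (𝓡 3) X → Prop) (e : AFEnd X)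
      (F : EuclideanSpace ℝ (Fin 1) → InitialDataSet (𝓡 3) X),
      InitialDataSet.IsTameDataFamily e 1 F →
        ((InitialDataSet.IsImmersedAtZero 1 F ∧ Injective F) ∨ ∀ c, F c = F 0) →
          (∀ c, F c ∈ admissibleVacuumData X) →
            (∀ c ≠ 0, (F c).HasExactKerrEnd ∧
              ∀ 𝒟 : VacuumCauchyDevelopment (F c), 𝒟.IsMaximal →
                Summit.FinalStateConjecture.HasCompleteNullInfinity 𝒟.toCauchyDevelopment) →
              ∃ (e' : AFEnd X) (G : EuclideanSpace ℝ (Fin 2) → InitialDataSet (𝓡 3) X),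
                InitialDataSet.IsTameDataFamily e' 2 G ∧
                  (∀ c : EuclideanSpace ℝ (Fin 1), G (EuclideanSpace.single 0 (c 0)) = F c) ∧
                  (∀ p, G p ∈ admissibleVacuumData X) ∧
                  (∀ p : EuclideanSpace ℝ (Fin 2), p 0 ≠ 0 → p 1 ≠ 0 → Settled (G p)) ∧
                  Injective (fun c : EuclideanSpace ℝ (Fin 1) ↦
                    G (EuclideanSpace.single 0 (c 0) + EuclideanSpace.single 1 (c 0))) ∧
                  InitialDataSet.IsImmersedAtZero 1 (fun c : EuclideanSpace ℝ (Fin 1) ↦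
                    G (EuclideanSpace.single 0 (c 0) + EuclideanSpace.single 1 (c 0)))

/-- NEGATION (typed obstruction to stub K / to C₂ at an extremal threshold): a TAME-OPEN extremal-forming
family — a censored Kerr-ended admissible datum `d` such that EVERY tame injective immersed admissible
curve through `d` has members arbitrarily close to `0` none of whose MGHDs admits an honest C⁰
decomposition with sub-extremal holes although one with `|aᵢ| ≤ Mᵢ` exists. Its existence refutes K (and,
with U's converse, C₂); arXiv:2402.10190 §1.4 predicts codimension ONE instead (no such `d`). Not
constructible in the tree (no MGHD is), hence not a usable stub today. -/
def TameOpenExtremalThreshold : Prop :=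
  ∃ (X : Type) (_ : TopologicalSpace X) (_ : ChartedSpace E3 X) (_ : IsManifold (𝓡 3) ∞ X)
    (_ : T2Space X) (_ : SecondCountableTopology X) (_ : ConnectedSpace X)
    (d : InitialDataSet (𝓡 3) X), d ∈ admissibleVacuumData X ∧ d.HasExactKerrEnd ∧
      ∀ (e : AFEnd X) (F : EuclideanSpace ℝ (Fin 1) → InitialDataSet (𝓡 3) X),
        InitialDataSet.IsTameDataFamily e 1 F → InitialDataSet.IsImmersedAtZero 1 F → Injective F →
          F 0 = d → (∀ c, F c ∈ admissibleVacuumData X) →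
            ∀ ε > (0 : ℝ), ∃ c : EuclideanSpace ℝ (Fin 1), c ≠ 0 ∧ ‖c‖ < ε ∧
              ∃ 𝒟 : VacuumCauchyDevelopment (F c), 𝒟.IsMaximal ∧
                (∃ (O : Set 𝒟.carrier) (d₀ : FinalStateDecomposition 𝒟.toSpacetime O 0),
                  O = Summit.FinalStateConjecture.exteriorOf 𝒟.toCauchyDevelopment d₀.charted ∧
                    Summit.FinalStateConjecture.HasExhaustiveCharts d₀) ∧
                ∀ (O : Set 𝒟.carrier) (d₁ : FinalStateDecomposition 𝒟.toSpacetime O 0),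
                  O = Summit.FinalStateConjecture.exteriorOf 𝒟.toCauchyDevelopment d₁.charted →
                    Summit.FinalStateConjecture.HasExhaustiveCharts d₁ →
                      ∃ i, ¬ Kerr.IsSubextremal (d₁.mass i) (d₁.spin i)

end Summit.FinalStateConjecture.FinalStateConjecture.Cruxes.SettlingAlongCensoredKerrEnds.KerrEndedAttraction
end
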